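import Mathlib
import Summits.ValiantsHypothesis.ValiantsHypothesis.Theses.ProofCarryingSymmetry
import Summits.ValiantsHypothesis.ValiantsHypothesis.Theorems.ProofCarryingSymmetryRestorationQPPCLayoutIso
import Literature.Computability.AlgebraicComplexity.SymmetricDetCircuitEval

/-!
# Route ProofCarryingSymmetry — crux `RestorationQP`, line `registered`: the determinant passes both dials

Support file for the crux item `stmt-ValiantsHypothesis-10343` (lead c4, cycle 4): the CALIBRATION of
the line at the flagship invariant VP family.  The route's thesis names the determinant as the test
case where "both short proofs of its identities (Hrubeš–Tzameret) and small symmetric circuits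
(Le Verrier, Dawar–Wilsenach Thm 4.1)" are available.  Here both dials of the line are read off at
`det` UNCONDITIONALLY and at POLYNOMIAL (not just quasi-polynomial) cost, from the tree's Le Verrier
circuit (`exists_isSymmetric_circuit_detPoly`, ≤ (n+2)⁴ gates) and the cycle-2 engine
`PCR.exists_piCircuit_pcProofs_of_isSymmetric` (a symmetric circuit, laid out as a straight-line
program, proves its own symmetry):

* `det_proofCarryingSymmetry` — for every `n` there is a Hrubeš–Tzameret circuit `C` over `ℂ` with
  `Ĉ = det_n`, `|C| ≤ (n+2)^13`, whose unfoldings `(C ∘ σ)•`, `C•` are equal modulo associativity and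
  commutativity for every `σ ∈ S_n` (the conclusion of the bet S2″ at `t = 0`), and all of whose
  invariance identities `C ∘ σ = C` have `P_c(ℂ)` proofs of size `≤ (n+2)^54` (the conclusion of the
  provability stub T′, polynomial form).
* `det_invarianceProvableP` — the T′-shaped corollary (eval, size, proofs) with one exponent `c = 54`.

So the determinant — the one VP-complete-flavoured invariant family for which restoration is a
theorem — sits at distributivity budget ZERO of the graded stability dial and has polynomial
invariance proofs; the permutation-invariance sub-case of Hrubeš–Tzameret's "short proofs for the
determinant identities" is recovered structurally (from symmetry) rather than from their explicit
Gaussian-elimination proofs.  Everything proved, no named facts.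
-/

-- single-problem summit: `Summit.ValiantsHypothesis.ValiantsHypothesis.…` is the namespace by design (D-0017)
set_option linter.dupNamespace false

namespace Summit.ValiantsHypothesis.ValiantsHypothesis.Theorems

open Literature.Computability.AlgebraicComplexity

/-- Size bookkeeping at `N ≤ (n+2)⁴`: `N·N·(N+2) ≤ (n+2)^13` and `310·(N+3)⁹ ≤ (n+2)^54`. [folklore] -/
theorem detProvability_bounds (n N : ℕ) (hN : N ≤ (n + 2) ^ 4) :
    N * N * (N + 2) ≤ (n + 2) ^ 13 ∧ 310 * (N + 3) ^ 9 ≤ (n + 2) ^ 54 := by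
  have h2 : 2 ≤ n + 2 := by omega
  have h16 : 16 ≤ (n + 2) ^ 4 :=
    calc (16 : ℕ) = 2 ^ 4 := by norm_num
      _ ≤ (n + 2) ^ 4 := Nat.pow_le_pow_left h2 4
  constructor
  · have hA : N + 2 ≤ 2 * (n + 2) ^ 4 := by omega
    calc N * N * (N + 2) ≤ (n + 2) ^ 4 * (n + 2) ^ 4 * (2 * (n + 2) ^ 4) :=
          Nat.mul_le_mul (Nat.mul_le_mul hN hN) hA
      _ = 2 * (n + 2) ^ 12 := by ring
      _ ≤ (n + 2) * (n + 2) ^ 12 := Nat.mul_le_mul_right _ h2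
      _ = (n + 2) ^ 13 := by ring
  · have hA : N + 3 ≤ 2 * (n + 2) ^ 4 := by omega
    have hB : (N + 3) ^ 9 ≤ 2 ^ 9 * (n + 2) ^ 36 :=
      calc (N + 3) ^ 9 ≤ (2 * (n + 2) ^ 4) ^ 9 := Nat.pow_le_pow_left hA 9
        _ = 2 ^ 9 * (n + 2) ^ 36 := by ring
    have hC : (310 * 2 ^ 9 : ℕ) ≤ (n + 2) ^ 18 :=
      calc (310 * 2 ^ 9 : ℕ) ≤ 2 ^ 18 := by norm_num
        _ ≤ (n + 2) ^ 18 := Nat.pow_le_pow_left h2 18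
    calc 310 * (N + 3) ^ 9 ≤ 310 * (2 ^ 9 * (n + 2) ^ 36) := Nat.mul_le_mul_left 310 hB
      _ = (310 * 2 ^ 9) * (n + 2) ^ 36 := by ring
      _ ≤ (n + 2) ^ 18 * (n + 2) ^ 36 := Nat.mul_le_mul_right _ hC
      _ = (n + 2) ^ 54 := by ring

/-- **The determinant passes both dials of the line, at polynomial cost.**  For every `n` there is a
Hrubeš–Tzameret straight-line circuit `C` over `ℂ` computing `det_n` with `|C| ≤ (n+2)^13` such that,
for every `σ ∈ S_n` (diagonal action `x_ij ↦ x_{σ i, σ j}`), the unfoldings `(C ∘ σ)•` and `C•` are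
equal modulo associativity and commutativity (`ACStability.ACEq` — the bet's conclusion at
distributivity budget `0`) AND the invariance identity `C ∘ σ = C` has a `P_c(ℂ)` proof of size
`≤ (n+2)^54` (the provability stub's conclusion).  Proof: Le Verrier's `S_n`-symmetric circuit
(`exists_isSymmetric_circuit_detPoly`, Dawar–Wilsenach Thm 4.1, ≤ (n+2)⁴ gates) fed to the cycle-2
engine `PCR.exists_piCircuit_pcProofs_of_isSymmetric`. [cite: DawarWilsenach2025, Thm. 4.1] -/
theorem det_proofCarryingSymmetry : ∀ n : ℕ, ∃ C : PICircuit ℂ (Fin n × Fin n), C.eval = detPoly (Fin n) ℂ ∧ C.size ≤ (n + 2) ^ 13 ∧ (∀ σ : Equiv.Perm (Fin n), ACStability.ACEq (C.rename fun x : Fin n × Fin n => σ • x).unfold C.unfold) ∧ ∀ σ : Equiv.Perm (Fin n), HasPCProofOfSize (C.rename fun x : Fin n × Fin n => σ • x) C ((n + 2) ^ 54) := by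
  intro n
  obtain ⟨G, hG, D, hsym, hev, hcard⟩ := exists_isSymmetric_circuit_detPoly ℂ n
  obtain ⟨C, -, hCev, hCsize, hCac, hCpc⟩ :=
    PCR.exists_piCircuit_pcProofs_of_isSymmetric (Γ := Equiv.Perm (Fin n)) D hsym () (fun _ => rfl)
  obtain ⟨h13, h54⟩ := detProvability_bounds n (Fintype.card G) hcard
  exact ⟨C, hCev.trans hev, hCsize.trans h13, hCac, fun σ => (hCpc σ).mono h54⟩

/-- **T′ at the determinant, polynomial form** (calibration of the provability stub
`stub_invarianceProvableQP'` at its flagship instance): one exponent `c` (= 54) such that for every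
`n` some straight-line circuit of size `≤ (n+2)^c` computes `det_n` and all its `S_n`-invariance
identities have `P_c(ℂ)` proofs of size `≤ (n+2)^c`. [cite: DawarWilsenach2025, Thm. 4.1] -/
theorem det_invarianceProvableP :
    ∃ c : ℕ, ∀ n : ℕ, ∃ C : PICircuit ℂ (Fin n × Fin n),
      C.eval = detPoly (Fin n) ℂ ∧ C.size ≤ (n + 2) ^ c ∧
      ∀ σ : Equiv.Perm (Fin n),
        HasPCProofOfSize (C.rename fun x : Fin n × Fin n => σ • x) C ((n + 2) ^ c) := by
  refine ⟨54, fun n => ?_⟩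
  obtain ⟨C, hev, hsize, -, hpc⟩ := det_proofCarryingSymmetry n
  exact ⟨C, hev, hsize.trans (Nat.pow_le_pow_right (by omega) (by norm_num)), hpc⟩

end Summit.ValiantsHypothesis.ValiantsHypothesis.Theorems
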